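import Mathlib
import HarnessLib
import Literature.Probability.LatticeModels.ProductMeasureTools
import Summits.Ventures.LatticeQCDFlow.Exactness.LatticeCoordAvg

/-!
# Conditional independence of disjoint blocks under a coordinate average: `A_s(F·G) = A_sF·A_sG` and `A_s(Π_j f_j) = Π_j A_s f_j` for functions of disjoint blocks (plus the kept coordinates)

HONEST FRAMING: exact (Metropolis-corrected) sampling algorithms for lattice gauge theory;
figures of merit are autocorrelation/cost numbers at stated couplings and volumes; no
continuum-physics claim.

Venture `LatticeQCDFlow` (cell pub-lqcd), topic `Exactness`; FANOUT row 7 (`s0-cpn-null`).  NEW WORK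
of the cell over the tree's `Exactness/LatticeCoordAvg.lean` (the coordinate average `A_s`: integrate
the `s`-coordinates out against fresh samples, keep the others) and the Literature's
`Probability/LatticeModels/ProductMeasureTools.integral_mul_eq_of_dependsOn_disjoint` (functions of
disjoint coordinate blocks are independent under a product measure); nothing is cited as a fact.  The
point: CONDITIONALLY ON THE KEPT COORDINATES, functions reading disjoint sets of averaged coordinates
are still independent — `A_s(F·G) = A_sF·A_sG` when `F` depends on `P ∪ sᶜ`, `G` on `Q ∪ sᶜ`,
`P ∩ Q = ∅` — and so are finite products.  This is the factorization step of the block tensorization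
of the SECOND MOMENT of a flow sampler's importance weights (sequel
`Exactness/LatticeBlockSecondMomentTensorization.lean`, with `Exactness/LatticeSecondMomentFloor.lean`),
the effective-sample-size companion of the entropy floor of `Exactness/LatticeBlockEntropyFloor.lean`
(which tensorizes after averaging the CORRIDOR instead).

## Content

* `dependsOn_coordAvg_of_dependsOn` (`A_s G` reads no more coordinates than `G`),
  `dependsOn_piecewise_of_dependsOn` (the glued function reads only `P` when `G` reads `P ∪ sᶜ`),
  `dependsOn_finset_prod_union`;
* **`coordAvg_mul_of_dependsOn_disjoint`**, **`coordAvg_finset_prod_of_dependsOn`**.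

NOT CLAIMED: anything about flows, weights or numbers.
-/

noncomputable section

namespace Summit.Ventures.LatticeQCDFlow.Exactness

open MeasureTheory Function
open scoped ENNReal

variable {ι : Type*} [Fintype ι] [DecidableEq ι]
variable {X : Type*} [MeasurableSpace X] [MetricSpace X] [CompactSpace X] [BorelSpace X]
  (μ : Measure X) [IsProbabilityMeasure μ]

/-! ## Conditional independence of disjoint blocks under a coordinate average -/

section Products

omit [MetricSpace X] [CompactSpace X] [BorelSpace X] [IsProbabilityMeasure μ] in
/-- `A_s G` depends on no more coordinates than `G` does. -/
theorem dependsOn_coordAvg_of_dependsOn (s : Finset ι) {G : (ι → X) → ℝ} {R : Set ι} (hG : DependsOn G R) :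
    DependsOn (coordAvg μ s G) R := by
  intro ω₁ ω₂ h
  unfold coordAvg
  refine integral_congr_ae (ae_of_all _ fun ω' => hG fun i hi => ?_)
  by_cases his : i ∈ s
  · rw [Finset.piecewise_eq_of_mem _ _ _ his, Finset.piecewise_eq_of_mem _ _ _ his]
  · rw [Finset.piecewise_eq_of_notMem _ _ _ his, Finset.piecewise_eq_of_notMem _ _ _ his]
    exact h i hi

omit [Fintype ι] [MeasurableSpace X] [MetricSpace X] [CompactSpace X] [BorelSpace X] in
/-- The glued function `ω' ↦ G(s.piecewise ω' ω)` depends only on the coordinates of `P` when `G` depends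
on `P ∪ sᶜ`. -/
theorem dependsOn_piecewise_of_dependsOn (s P : Finset ι) {G : (ι → X) → ℝ}
    (hG : DependsOn G (↑P ∪ (↑s)ᶜ)) (ω : ι → X) :
    DependsOn (fun ω' : ι → X => G (s.piecewise ω' ω)) ↑P := by
  intro ω₁ ω₂ h
  refine hG fun i hi => ?_
  by_cases his : i ∈ s
  · rw [Finset.piecewise_eq_of_mem _ _ _ his, Finset.piecewise_eq_of_mem _ _ _ his]
    rcases hi with hiP | hiC
    · exact h i hiP
    · exact absurd (Finset.mem_coe.2 his) hiC
  · rw [Finset.piecewise_eq_of_notMem _ _ _ his, Finset.piecewise_eq_of_notMem _ _ _ his]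

/-- **Two functions of disjoint blocks are conditionally independent under `A_s`**:
`A_s(F·G) = A_s F · A_s G` if `F` depends on `P ∪ sᶜ`, `G` on `Q ∪ sᶜ`, `P ∩ Q = ∅` (continuous `F`, `G`). -/
theorem coordAvg_mul_of_dependsOn_disjoint (s : Finset ι) {P Q : Finset ι} (hPQ : Disjoint P Q)
    {F G : (ι → X) → ℝ} (hF : Continuous F) (hG : Continuous G)
    (hFd : DependsOn F (↑P ∪ (↑s)ᶜ)) (hGd : DependsOn G (↑Q ∪ (↑s)ᶜ)) (ω : ι → X) :
    coordAvg μ s (fun ω => F ω * G ω) ω = coordAvg μ s F ω * coordAvg μ s G ω := by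
  unfold coordAvg
  have hglue : Continuous fun ω' : ι → X => s.piecewise ω' ω :=
    (continuous_piecewise_prod s).comp (Continuous.prodMk_right ω)
  rw [← Measure.infinitePi_eq_pi]
  exact Literature.Probability.LatticeModels.integral_mul_eq_of_dependsOn_disjoint (fun _ : ι => μ) hPQ
    (hF.comp hglue).measurable (hG.comp hglue).measurable
    (dependsOn_piecewise_of_dependsOn s P hFd ω) (dependsOn_piecewise_of_dependsOn s Q hGd ω)

omit [Fintype ι] [DecidableEq ι] [MeasurableSpace X] [MetricSpace X] [CompactSpace X] [BorelSpace X] in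
/-- A finite product of functions depending on sets `R_j` depends on their union. -/
theorem dependsOn_finset_prod_union {J : Type*} (T : Finset J) {f : J → (ι → X) → ℝ} {R : J → Set ι}
    (hf : ∀ j ∈ T, DependsOn (f j) (R j)) :
    DependsOn (fun ω : ι → X => ∏ j ∈ T, f j ω) (⋃ j ∈ T, R j) := by
  intro ω₁ ω₂ h
  exact Finset.prod_congr rfl fun j hj => hf j hj fun i hi => h i (Set.mem_biUnion hj hi)

/-- **A product of block-local functions factorizes under `A_s`**: for pairwise disjoint `P_j` and
continuous `f_j` depending on `P_j ∪ sᶜ`, `A_s(Π_j f_j) = Π_j A_s f_j`. -/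
theorem coordAvg_finset_prod_of_dependsOn {J : Type*} (T : Finset J) (s : Finset ι) (P : J → Finset ι)
    (hP : ∀ j ∈ T, ∀ j' ∈ T, j ≠ j' → Disjoint (P j) (P j'))
    {f : J → (ι → X) → ℝ} (hc : ∀ j ∈ T, Continuous (f j))
    (hdep : ∀ j ∈ T, DependsOn (f j) (↑(P j) ∪ (↑s)ᶜ)) (ω : ι → X) :
    coordAvg μ s (fun ω => ∏ j ∈ T, f j ω) ω = ∏ j ∈ T, coordAvg μ s (f j) ω := by
  classical
  induction T using Finset.induction_on with
  | empty => simp [coordAvg_const]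
  | @insert a T haT ih =>
    have hP' : ∀ j ∈ T, ∀ j' ∈ T, j ≠ j' → Disjoint (P j) (P j') :=
      fun j hj j' hj' hne => hP j (Finset.mem_insert_of_mem hj) j' (Finset.mem_insert_of_mem hj') hne
    have hc' : ∀ j ∈ T, Continuous (f j) := fun j hj => hc j (Finset.mem_insert_of_mem hj)
    have hdep' : ∀ j ∈ T, DependsOn (f j) (↑(P j) ∪ (↑s)ᶜ) := fun j hj => hdep j (Finset.mem_insert_of_mem hj)
    simp only [Finset.prod_insert haT]
    rw [← ih hP' hc' hdep']
    have hdisj : Disjoint (P a) (T.biUnion P) := by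
      rw [Finset.disjoint_biUnion_right]
      intro j hj
      exact hP a (Finset.mem_insert_self a T) j (Finset.mem_insert_of_mem hj) (fun h => haT (h ▸ hj))
    have hGc : Continuous fun ω : ι → X => ∏ j ∈ T, f j ω := continuous_finsetProd T fun j hj => hc' j hj
    have hGdep : DependsOn (fun ω : ι → X => ∏ j ∈ T, f j ω) (↑(T.biUnion P) ∪ (↑s)ᶜ) := by
      have h1 := dependsOn_finset_prod_union T (R := fun j => (↑(P j) ∪ (↑s)ᶜ : Set ι)) hdep'
      refine fun ω₁ ω₂ h => h1 fun i hi => h i ?_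
      rw [Finset.coe_biUnion]
      obtain ⟨j, hj, hij⟩ := Set.mem_iUnion₂.1 hi
      rcases hij with hij | hij
      · exact Or.inl (Set.mem_biUnion (Finset.mem_coe.2 hj) hij)
      · exact Or.inr hij
    exact coordAvg_mul_of_dependsOn_disjoint μ s hdisj (hc a (Finset.mem_insert_self a T)) hGc
      (hdep a (Finset.mem_insert_self a T)) hGdep ω

end Products

end Summit.Ventures.LatticeQCDFlow.Exactness

end
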